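import Summits.BirchSwinnertonDyer.BirchSwinnertonDyer.Theorems.PrintCf2RamifiedOffTYZMoverBlockFormSixAll
import Literature.NumberTheory.EllipticCurves.TianYuanZhang2017.CMPointFrobeniusValueDisplays
import Literature.NumberTheory.QuadraticFields.RamifiedPrimeProductNotPrincipal
import HarnessLib

/-!
# Crux `PrintCf2.RamifiedOffTYZOfFacts` (stmt-BirchSwinnertonDyer-20509), line `offtyz-v7`, LEAD cycle 14 (cruxlead-20509 g13):
# THE REGIME-FREE BLOCK FORM ON A BLOCK `d ≡ 6 (mod 8)`, PART IV — on `Pic(𝒪₄)` from the printed class values (F4)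

THEOREMS ONLY (no `def`, no named fact, no `sorry`), `--supports stmt-BirchSwinnertonDyer-20509`.  Sequel of `…MoverBlockFormSixAll` (the law on an
abstract dictionary `ρ : Gal(ℍ′_n/K_d) ↠ G` with the (F4)-type hypothesis `hval`).  Here `G = Pic(𝒪₄) = I_{K_d}(4)/P_{K_d,ℤ}(4)`
(`RingClassGroup (GenusField d) 4`, the display `RingClassFourBlockSpec`) and the Frobenius elements WITH THEIR CLASSES are those of ty2's display
`FrobeniusFourValueBlockSpec` (p733876: (F1)–(F4), `toClassGroup (ρ₄ φ_q) = [𝔭_q]`, `𝔭_q² = (q)`):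
* §1 `hval` holds on `Pic(𝒪₄)`: for `w ≠ 0` the product `∏_{w_j = 1} ρ₄(φ_j)` maps to `∏_{w_j=1} [𝔭_{q_j}] ≠ 1` in `Cl(𝒪_{K_d})` — a non-empty product of
  ramified ODD primes of `K_d = ℚ(√−d)`, `d = 2q₁⋯q_m`, is not principal (ty2's `RedeiReichardt.prod_classGroupMk0_pow_ne_one_of_sq_eq_span`, p741420,
  with the extra prime `2 ∣ d`) — so it is neither `1` nor `ρ₄(σ)` (both map to `1`, (RC2)).
* §2 **`sqMotion_eq_kerSum_dotProduct_bits_six_of_value`**: for every block `d = 2q₁⋯q_m ≡ 6 (mod 8)` of a square-free `n` carrying `CMBlockSpec`,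
  the lift of `σ_{1+ϖ}`, `RingClassFourBlockSpec` and `FrobeniusFourValueBlockSpec`, and every `g ∈ Gal(ℍ′_n/K_d)`:
  `[(g·g)^{g(d)}σ⁻¹ ∈ Gal(ℍ′_n/H′_d)] = Σ_c kerSum(N_d)_c · x_c(g)` — NO `g(d)` odd, NO `#ker N_d = 2`.
* §3 the same from the block clauses of `CMPointRingClassFrobeniusValuePrinted` (consumer shape, `…_of_clauses`).
BSD is not proved by any of this; no class is closed by this file.

References: [cite: TianYuanZhang2017, §3.1 (p0011 L1–L13, L53–L64), Prop. 3.2 (2) (p0010 L111–L113), Thm. 3.6 (2), proof of Lemma 3.21 (p0020 L50–L63)];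
[cite: Cox2013, §5.C Lemma 5.19, (5.22), Thm. 5.23, Cor. 5.25 (PDF pp. 122–124), §9.A (PDF pp. 192–193)]; [cite: Stevenhagen1995RedeiMatrices, §2];
[cite: Rotman1995, Thm. 2.19 (PDF p. 37)].
-/

noncomputable section

open scoped Classical NumberField nonZeroDivisors

open WeierstrassCurve WeierstrassCurve.Affine Finset Matrix Literature.NumberTheory.EllipticCurves
  Literature.NumberTheory.EllipticCurves.TianYuanZhang2017
  Literature.NumberTheory.EllipticCurves.TianYuanZhang2017.W2
  Literature.NumberTheory.EllipticCurves.HeathBrown1994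
  Literature.NumberTheory.EllipticCurves.HeathBrown1994.Families
  Literature.NumberTheory.EllipticCurves.Smith2016
  Literature.NumberTheory.QuadraticFields.RingClass
  Literature.NumberTheory.QuadraticFields
  Summit.BirchSwinnertonDyer.Rank1Residual.P2.GenusPeriodTransferLayer
  Summit.BirchSwinnertonDyer.PrintCf2.QForm

set_option autoImplicit false

namespace Summit.BirchSwinnertonDyer.PrintCf2.MoverAssembly

variable {n : ℕ} (D : GenusPointData n)
variable {m : ℕ} (q : Fin m → ℕ) (hq : ∀ j, (q j).Prime) (hqodd : ∀ j, Odd (q j)) (hqinj : Function.Injective q)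
variable {d : ℕ} {z : APoint D.H} {Φ : Finset (D.H ≃ₐ[ℚ] D.H)} {ΓH ΓH' : Subgroup (D.H ≃ₐ[ℚ] D.H)} {σ c : D.H ≃ₐ[ℚ] D.H}
variable {ρ : D.galK d →* RingClassGroup (GenusField d) 4}

/-! ## §1 The (F4)-type hypothesis `hval` on `Pic(𝒪₄)` -/

/-- `x^{[u = 1]} = x^{u.val}` for `u : 𝔽₂`. [folklore] -/
theorem ite_eq_one_eq_pow_val {M : Type*} [Monoid M] (x : M) (u : ZMod 2) : (if u = 1 then x else 1) = x ^ u.val := by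
  have h01 : ∀ t : ZMod 2, t = 0 ∨ t = 1 := by decide
  rcases h01 u with rfl | rfl
  · rw [if_neg (by decide), ZMod.val_zero, pow_zero]
  · rw [if_pos rfl, show (1 : ZMod 2).val = 1 from rfl, pow_one]

include hq hqodd hqinj in
/-- **A non-empty product of the Frobenius classes of the odd primes of `d = 2q₁⋯q_m` is non-trivial on the Hilbert class field**: under (F4)
(`toClassGroup (ρ₄ φ_j) = [𝔭_{q_j}]`, `𝔭_{q_j}² = (q_j)`), `toClassGroup (∏_{w_j=1} ρ₄ φ_j) = ∏_{w_j=1}[𝔭_{q_j}] ≠ 1` for `w ≠ 0` — the prime `2 ∣ d` is not among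
the `q_j`, so the product of ramified primes is neither empty nor `(√−d)` (Stevenhagen §2 via ty2's `prod_classGroupMk0_pow_ne_one_of_sq_eq_span`).
[cite: Stevenhagen1995RedeiMatrices, §2 (proof of Thm. 1)] [cite: Cox2013, §5.C Thm. 5.23, Cor. 5.25 (PDF pp. 123–124)] -/
theorem toClassGroup_prod_frobenius_ne_one (hdsq : Squarefree d) (hprod : 2 * ∏ j, q j = d) (φ : Fin m → D.galK d)
    (P : Fin m → Ideal (𝓞 (GenusField d))) (hP0 : ∀ j, P j ∈ (Ideal (𝓞 (GenusField d)))⁰)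
    (hP2 : ∀ j, P j ^ 2 = Ideal.span {((q j : ℕ) : 𝓞 (GenusField d))})
    (hval : ∀ j, toClassGroup (GenusField d) 4 (ρ (φ j)) = ClassGroup.mk0 ⟨P j, hP0 j⟩) {w : Fin m → ZMod 2} (hw : w ≠ 0) :
    toClassGroup (GenusField d) 4 (∏ j, (if w j = 1 then ρ (φ j) else 1)) ≠ 1 := by
  have hd0 : 0 < d := Nat.pos_of_ne_zero hdsq.ne_zero
  obtain ⟨x, hx⟩ := GenusPointData.exists_ringOfIntegers_sq_eq_neg_genusField hd0
  have hq2 : ∀ j, q j ≠ 2 := fun j h2 => by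
    have := hqodd j; rw [h2] at this; exact (Nat.not_odd_iff_even.mpr even_two) this
  have hqd : ∀ j, q j ∣ d := fun j => hprod ▸ Dvd.dvd.mul_left (Finset.dvd_prod_of_mem q (mem_univ j)) 2
  have h2d : 2 ∣ d := hprod ▸ dvd_mul_right 2 _
  rw [map_prod]
  have hfac : ∀ j, toClassGroup (GenusField d) 4 (if w j = 1 then ρ (φ j) else 1) = ClassGroup.mk0 ⟨P j, hP0 j⟩ ^ (w j).val := by
    intro j
    rw [← ite_eq_one_eq_pow_val, ← hval j]
    split_ifs
    · rfl
    · exact map_one _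
  rw [Finset.prod_congr rfl (fun j _ => hfac j)]
  exact RedeiReichardt.prod_classGroupMk0_pow_ne_one_of_sq_eq_span (finrank_genusField d) hdsq hx hq hqinj hqd Nat.prime_two h2d
    (fun j => (hq2 j).symm) hP2 hP0 hw

include hq hqodd hqinj in
/-- **`hval` on `Pic(𝒪₄)`**: for `w ≠ 0`, `∏_{w_j=1} ρ₄(φ_j)` is neither `1` nor `ρ₄(σ)` — both have trivial image in `Cl(𝒪_{K_d})` ((RC2): `σ ∈ Gal(ℍ′_n/H_d)`),
the product has not (`toClassGroup_prod_frobenius_ne_one`). [cite: Cox2013, §5.C Cor. 5.25, §9.A] [cite: TianYuanZhang2017, Prop. 3.2 (2)] -/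
theorem prod_frobenius_ne_one_and_ne_rho_sigma (hdsq : Squarefree d) (hprod : 2 * ∏ j, q j = d) (h : D.CMBlockSpec d z Φ ΓH ΓH' σ c)
    (hRC : D.RingClassFourBlockSpec d ΓH ΓH' ρ) (φ : Fin m → D.galK d)
    (P : Fin m → Ideal (𝓞 (GenusField d))) (hP0 : ∀ j, P j ∈ (Ideal (𝓞 (GenusField d)))⁰)
    (hP2 : ∀ j, P j ^ 2 = Ideal.span {((q j : ℕ) : 𝓞 (GenusField d))})
    (hval : ∀ j, toClassGroup (GenusField d) 4 (ρ (φ j)) = ClassGroup.mk0 ⟨P j, hP0 j⟩) (w : Fin m → ZMod 2) (hw : w ≠ 0) :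
    (∏ j, (if w j = 1 then ρ (φ j) else 1)) ≠ 1 ∧
      (∏ j, (if w j = 1 then ρ (φ j) else 1)) ≠ ρ ⟨σ, D.sigma_mem_galK_of_cmBlockSpec h⟩ := by
  have hne := toClassGroup_prod_frobenius_ne_one D q hq hqodd hqinj hdsq hprod φ P hP0 hP2 hval hw
  refine ⟨fun h1 => hne (by rw [h1, map_one]), fun h1 => hne ?_⟩
  rw [h1]
  exact (hRC.2.2.1 _).mpr h.2.2.2.2.2.1.1

/-! ## §2 The block form on `Pic(𝒪₄)` from the class values -/

include hq hqodd hqinj in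
/-- **THE BLOCK FORM ON A BLOCK `d ≡ 6 (mod 8)`, ALL REGIMES, from the printed displays.**  For a block `d = 2q₁⋯q_m` of a square-free `n` with
`CMBlockSpec`, the lift `θ` of `σ_{1+ϖ}` (`θθσ⁻¹ ∈ Gal(ℍ′_n/H′_d)`), the ring class dictionary `ρ₄ : Gal(ℍ′_n/K_d) ↠ Pic(𝒪₄)` (`RingClassFourBlockSpec`) and
the Frobenius elements of the odd `q ∣ d` with their classes (`FrobeniusFourValueBlockSpec`), EVERY `g ∈ Gal(ℍ′_n/K_d)` satisfies
`[(g·g)^{g(d)}σ⁻¹ ∈ Gal(ℍ′_n/H′_d)] = Σ_c (kerSum N_d)_c · x_c(g)` (`N_d = [[A_d + D₋₂, z_d],[0,0]]`, `x(g) = ([g moves i√−q_i])_i ; [g moves i√−2])`) —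
g8's `sqMotion_eq_kerSum_dotProduct_bits_six` WITHOUT `Odd (gK d)` and WITHOUT `#ker N_d = 2`.
[cite: TianYuanZhang2017, §3.1 (p0011 L1–L13, L53–L64), Prop. 3.2 (2), Thm. 3.6 (2), proof of Lemma 3.21 (p0020 L50–L63)]
[cite: Cox2013, §5.C Lemma 5.19, (5.22), Thm. 5.23, Cor. 5.25, §9.A] [cite: Rotman1995, Thm. 2.19 (PDF p. 37)] -/
theorem sqMotion_eq_kerSum_dotProduct_bits_six_of_value (hn : Squarefree n) (hd : d ∈ n.divisors) (hd8 : d % 8 = 6)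
    (hprod : 2 * ∏ j, q j = d) (h : D.CMBlockSpec d z Φ ΓH ΓH' σ c)
    {θ : D.H ≃ₐ[ℚ] D.H} (hθd : θ (D.sqrtNeg d) = D.sqrtNeg d) (hθ : θ * θ * σ⁻¹ ∈ ΓH')
    (hRC : D.RingClassFourBlockSpec d ΓH ΓH' ρ) (hV : D.FrobeniusFourValueBlockSpec d ΓH' ρ)
    (g : D.H ≃ₐ[ℚ] D.H) (hg : g (D.sqrtNeg d) = D.sqrtNeg d) :
    (if (g * g) ^ gK d * σ⁻¹ ∈ ΓH' then (1 : ZMod 2) else 0) =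
      ∑ c, kerSum (Matrix.fromBlocks (legendreMatrix q + legendreDiagonal q (-2)) (Matrix.of fun j (_ : Unit) => addLegendreSym 2 (q j))
          (0 : Matrix Unit (Fin m) (ZMod 2)) (0 : Matrix Unit Unit (ZMod 2))) c *
        Sum.elim (fun i => if g (D.im * D.sqrtNeg (q i)) = D.im * D.sqrtNeg (q i) then (0 : ZMod 2) else 1)
          (fun (_ : Unit) => if g (D.im * D.sqrtNeg 2) = D.im * D.sqrtNeg 2 then (0 : ZMod 2) else 1) c := by
  haveI : Finite (RingClassGroup (GenusField d) 4) := finite_ringClassGroup (finrank_genusField d) (by norm_num)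
  have hdsq : Squarefree d := hn.squarefree_of_dvd (Nat.dvd_of_mem_divisors hd)
  have hn0 : n ≠ 0 := hn.ne_zero
  have hq2 : ∀ j, q j ≠ 2 := fun j h2 => by
    have := hqodd j; rw [h2] at this; exact (Nat.not_odd_iff_even.mpr even_two) this
  have hqd : ∀ j, q j ∣ d := fun j => hprod ▸ Dvd.dvd.mul_left (Finset.dvd_prod_of_mem q (mem_univ j)) 2
  have hqn : ∀ j, q j ∣ n := fun j => (hqd j).trans (Nat.dvd_of_mem_divisors hd)
  have h2n : 2 ∣ n := (hprod ▸ dvd_mul_right 2 _ : 2 ∣ d).trans (Nat.dvd_of_mem_divisors hd)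
  choose φ hF2 hFi hFr P hP0 hP2 hval using fun j => hV (q j) (hq j) (hqd j) (hq2 j)
  have hφ : ∀ j, (φ j : D.H ≃ₐ[ℚ] D.H) * (φ j : D.H ≃ₐ[ℚ] D.H) ∈ ΓH' ∧
      (φ j : D.H ≃ₐ[ℚ] D.H) D.im = (jacobiSym (-1) (q j)) • D.im ∧
      (φ j : D.H ≃ₐ[ℚ] D.H) (D.sqrtNeg 2) = (jacobiSym (-2) (q j)) • D.sqrtNeg 2 ∧
      ∀ i, i ≠ j → (φ j : D.H ≃ₐ[ℚ] D.H) (D.sqrtNeg (q i)) = (jacobiSym (-(q i : ℤ)) (q j)) • D.sqrtNeg (q i) := by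
    intro j
    refine ⟨hF2 j, hFi j, ?_, fun i hij => hFr j (q i) (hq i) (hqn i) (fun h => hij (hqinj h))⟩
    have h := hFr j 2 Nat.prime_two h2n (hq2 j).symm
    simpa using h
  have hval' : ∀ w : Fin m → ZMod 2, w ≠ 0 →
      (∏ j, (if w j = 1 then ρ (φ j) else 1)) ≠ 1 ∧
        (∏ j, (if w j = 1 then ρ (φ j) else 1)) ≠ ρ ⟨σ, D.sigma_mem_galK_of_cmBlockSpec h⟩ :=
    prod_frobenius_ne_one_and_ne_rho_sigma D q hq hqodd hqinj hdsq hprod h hRC φ P hP0 hP2 hval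
  exact sqMotion_eq_kerSum_dotProduct_bits_six_all D q hq hqodd hqinj hn hd hd8 hprod h hRC.1 hRC.2.1 hRC.2.2.2 hθd hθ φ hφ hval' g hg

/-! ## §3 Consumer shape: from the block clauses of `CMPointRingClassFrobeniusValuePrinted` -/

include hq hqodd hqinj in
/-- **The regime-free block form from the block clauses of `CMPointRingClassFrobeniusValuePrinted`** (the eight per-block conjuncts, as unpacked by
every consumer of ty2's p733876), for a block `d = 2q₁⋯q_m ∈ n.divisors`, `d ≡ 6 (mod 8)`, and every `g ∈ Gal(ℍ′_n/K_d)`.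
[cite: TianYuanZhang2017, §3.1, Prop. 3.2 (2), Thm. 3.6 (2), proof of Lemma 3.21] [cite: Cox2013, §5.C, §9.A] -/
theorem sqMotion_eq_kerSum_dotProduct_bits_six_of_clauses (hn : Squarefree n)
    {zf : ℕ → APoint D.H} {Φf : ℕ → Finset (D.H ≃ₐ[ℚ] D.H)} {ΓHf ΓH'f : ℕ → Subgroup (D.H ≃ₐ[ℚ] D.H)}
    {σf θf : ℕ → (D.H ≃ₐ[ℚ] D.H)} {cf : D.H ≃ₐ[ℚ] D.H}
    {ρ₂ : (d : ℕ) → (D.galK d →* RingClassGroup (GenusField d) 2)}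
    {ρ₄ : (d : ℕ) → (D.galK d →* RingClassGroup (GenusField d) 4)}
    (hb : ∀ d ∈ n.divisors,
      ((d % 8 = 5 ∨ d % 8 = 6) → D.CMBlockSpec d (zf d) (Φf d) (ΓHf d) (ΓH'f d) (σf d) cf) ∧
      (d % 8 = 6 → D.ThetaBlockSpec d (zf d) (ΓHf d) (ΓH'f d) (σf d) (θf d)) ∧
      (d % 8 = 7 → D.SevenBlockSpec d) ∧
      (d % 8 = 5 → D.RingClassTwoBlockSpec d (ΓHf d) (ΓH'f d) (ρ₂ d)) ∧
      (d % 8 = 6 → D.RingClassFourBlockSpec d (ΓHf d) (ΓH'f d) (ρ₄ d)) ∧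
      (d % 8 = 5 → D.FrobeniusTwoBlockSpec d (ΓH'f d)) ∧
      (d % 8 = 6 → D.FrobeniusFourBlockSpec d (ΓH'f d)) ∧
      (d % 8 = 6 → D.FrobeniusFourValueBlockSpec d (ΓH'f d) (ρ₄ d)))
    (hd : d ∈ n.divisors) (hd8 : d % 8 = 6) (hprod : 2 * ∏ j, q j = d)
    (g : D.H ≃ₐ[ℚ] D.H) (hg : g (D.sqrtNeg d) = D.sqrtNeg d) :
    (if (g * g) ^ gK d * (σf d)⁻¹ ∈ ΓH'f d then (1 : ZMod 2) else 0) =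
      ∑ c, kerSum (Matrix.fromBlocks (legendreMatrix q + legendreDiagonal q (-2)) (Matrix.of fun j (_ : Unit) => addLegendreSym 2 (q j))
          (0 : Matrix Unit (Fin m) (ZMod 2)) (0 : Matrix Unit Unit (ZMod 2))) c *
        Sum.elim (fun i => if g (D.im * D.sqrtNeg (q i)) = D.im * D.sqrtNeg (q i) then (0 : ZMod 2) else 1)
          (fun (_ : Unit) => if g (D.im * D.sqrtNeg 2) = D.im * D.sqrtNeg 2 then (0 : ZMod 2) else 1) c := by
  obtain ⟨hCM, hT, -, -, hRC, -, -, hV⟩ := hb d hd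
  obtain ⟨hθd, -, -, hθ⟩ := hT hd8
  exact sqMotion_eq_kerSum_dotProduct_bits_six_of_value D q hq hqodd hqinj hn hd hd8 hprod (hCM (Or.inr hd8)) hθd hθ (hRC hd8) (hV hd8) g hg

end Summit.BirchSwinnertonDyer.PrintCf2.MoverAssembly

end
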